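import Summits.ResolutionOfSingularities.ResolutionOfSingularities.Theorems.HilbertSamuelEliminationSigmaMaxModificationsCorridor3WLadderIsoInsepE2NearNoJumpRow
import Summits.ResolutionOfSingularities.ResolutionOfSingularities.Theorems.HilbertSamuelEliminationSigmaMaxModificationsCorridor3WLadderIsoInsepE2NearRationalRow
import Summits.ResolutionOfSingularities.ResolutionOfSingularities.Theorems.HilbertSamuelEliminationSigmaMaxModificationsCorridor3WLadderIsoInsepTailCutK1
import Summits.ResolutionOfSingularities.ResolutionOfSingularities.Theorems.HilbertSamuelEliminationSigmaMaxModificationsCorridor3WLadderIsoInsepDoublePointPropagates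
import HarnessLib

/-!
# [OURS · L1 W4.2] E2 chart calculus, brick 20: THE k2 JOINS WITH THE RC ROW AND THE NO-JUMP ROW DISCHARGED (universe `0`)
# (crux chain w42, cell k2 `T3insep` = `stub_isoInsepTower`; `--supports stmt-ResolutionOfSingularities-19249`)

OURS (cell res-hironaka, slot W4.2, seat res-D-pv-042; OWN OBJECT TUO 2026-08-27 18:19Z, close-out); NOT a statement of [Hironaka2017]
nor of [CossartJannsenSaito2020] / [CossartPiltant2008]. AI-drafted, weaker than expert review. PROOF file, def-free, fact-free; pure
logic over the cell's typed joins (`…IsoInsepDoublePointPropagates`, `…IsoInsepTailCutK1`) with the two rows proved in bricks 18b/19b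
(`isoInsepE2SuccRational₂_holds`, `isoInsepE2SuccInsep₂_holds`, both at universe `0`, the universe of the chart presentations).

* `isoInsepE2Propagates₂_of_E0_E1` — E2-propagation from the E0 and E1 rows alone (NO-JUMP and double-point propagation proved).
* `isoInsepE2TailImpossible₂_of_E0_E1_K3`, `e2Tail_satelliteRecurrent_of_E0_E1` — the E2-tail exclusions at level `3` from E0, E1 and
  the shared kernel K3 (RC, NO-JUMP, propagation, K1 proved).
* `isoInsepTowerTerminates₂_of_E0_E1_K3` — **k2 at `p = 2`, level `3`: `E0 → E1 → k2c → K3 → IsoInsepTowerTerminates 2 3`**; the rows RC,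
  NO-JUMP, double-point propagation and K1 are no longer hypotheses.

## References

* V. Cossart, U. Jannsen, S. Saito, LNM 2270 (2020): Def. 6.38, Thm. 6.40. [CossartJannsenSaito2020]
* V. Cossart, O. Piltant, J. Algebra 321 (2009), ch. 3 I.10 (Dis). [CossartPiltant2009]
-/

noncomputable section

set_option linter.dupNamespace false

open Literature.AlgebraicGeometry.Resolution Literature.AlgebraicGeometry.CossartJannsenSaito2020
open Summit.ResolutionOfSingularities.ResolutionOfSingularities.Theorems.CampaignW42
open Summit.ResolutionOfSingularities.ResolutionOfSingularities.Theorems.SigmaMaxModificationsCorridor3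
open Summit.ResolutionOfSingularities.ResolutionOfSingularities.Cruxes.SigmaMaxModifications.IdeasL1Idea2R4 (IsIsoPointTower)
open Summit.ResolutionOfSingularities.ResolutionOfSingularities.Cruxes.SigmaMaxModifications.IdeasL1C5

namespace Summit.ResolutionOfSingularities.ResolutionOfSingularities.Cruxes.SigmaMaxModifications.IdeasL1C6

/-- **E2-propagation from E0 and E1 alone** (NO-JUMP = brick 19b, double-point propagation = `isoDoublePointPropagates₂_holds`).
[OURS · L1 W4.2 · k2 · brick 20] [folklore] -/
theorem isoInsepE2Propagates₂_of_E0_E1 {N : ℕ} (h0 : IsoInsepE0Impossible₂.{0} N) (h1 : IsoInsepE1Impossible₂.{0} N) :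
    IsoInsepE2Propagates₂.{0} N :=
  isoInsepE2Propagates₂_of_noJump' h0 h1 (isoInsepE2SuccInsep₂_holds N)

/-- **No E2 tail at level `3`, from E0, E1 and K3** (RC = brick 18b, NO-JUMP = brick 19b, K1 = `IsoTailsHS.isoFreeRationalTailsImpossible_holds`).
[OURS · L1 W4.2 · k2 · brick 20] [cite: CossartPiltant2009, ch. 3 I.10 (Dis)] -/
theorem isoInsepE2TailImpossible₂_of_E0_E1_K3 (h0 : IsoInsepE0Impossible₂.{0} 3) (h1 : IsoInsepE1Impossible₂.{0} 3)
    (hK3 : IsoSatelliteRecurrentImpossible.{0} 2 3) : IsoInsepE2TailImpossible₂.{0} 3 :=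
  isoInsepE2TailImpossible₂_of_RC_K3 (isoInsepE2SuccRational₂_holds 3) (isoInsepE2Propagates₂_of_E0_E1 h0 h1) hK3

/-- **Every E2 tail at level `3` is satellite-recurrent, from E0 and E1 alone** (RC, NO-JUMP, propagation, K1 proved).
[OURS · L1 W4.2 · k2 · brick 20] [cite: CossartPiltant2009, ch. 3 I.10 (Dis)] -/
theorem e2Tail_satelliteRecurrent_of_E0_E1 (h0 : IsoInsepE0Impossible₂.{0} 3) (h1 : IsoInsepE1Impossible₂.{0} 3)
    {ν : ℕ → ℕ} {T : BlowupTower.{0}} {pt : ∀ n, T.X n} (hO : IsMaximalOrigin 2 3 ν (T.X 0) (pt 0)) (hT : IsIsoPointTower 3 ν T pt)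
    {n₀ : ℕ} (h₀ : IsE2Stage T pt n₀) : ∀ n₁, ∃ n, n₁ ≤ n ∧ IsSatelliteStep T pt n :=
  e2Tail_satelliteRecurrent (isoInsepE2SuccRational₂_holds 3) (isoInsepE2Propagates₂_of_E0_E1 h0 h1) hO hT h₀

/-- **k2 AT `p = 2`, LEVEL `3`: `E0 → E1 → k2c → K3 → IsoInsepTowerTerminates 2 3`** — the RC row, the NO-JUMP row, double-point
propagation and K1 are discharged; what remains are the E0/E1 rows, the non-double-recurrent row k2c and the shared kernel
K3 = `IsoSatelliteRecurrentImpossible 2 3`. [OURS · L1 W4.2 · k2 · brick 20] [cite: CossartPiltant2009, ch. 3 I.10 (Dis)]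
[cite: CossartJannsenSaito2020, Def. 6.38] -/
theorem isoInsepTowerTerminates₂_of_E0_E1_K3 (h0 : IsoInsepE0Impossible₂.{0} 3) (h1 : IsoInsepE1Impossible₂.{0} 3)
    (hc : IsoInsepNonDoubleRecurrentImpossible₂.{0} 3) (hK3 : IsoSatelliteRecurrentImpossible.{0} 2 3) :
    IsoInsepTowerTerminates.{0} 2 3 :=
  isoInsepTowerTerminates₂_of_RC_K3 h0 h1 hc (isoInsepE2SuccRational₂_holds 3) (isoInsepE2Propagates₂_of_E0_E1 h0 h1) hK3

end Summit.ResolutionOfSingularities.ResolutionOfSingularities.Cruxes.SigmaMaxModifications.IdeasL1C6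

end
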